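import Summits.QuantumFields.YangMills.Theses.WeakCouplingMasslessPhase

/-!
# Route `WeakCouplingMasslessPhase` — the Assembly item (stmt-QuantumFields-19522)

`Assembly : WeakCouplingPerimeterLawD4 → DeconfinedIsMassless → ¬ YangMills` is, verbatim, the route's deciding theorem
`WeakCouplingMasslessPhase.closes` (refutation form).  This file records the closure BY NAME.  HONEST LABEL: both hypotheses are OPEN cruxes of
the route; NOTHING about `YangMills` or its negation is proved here — modus ponens bookkeeping only.

References: A. Jaffe, E. Witten (2000) [JaffeWitten2000].
-/

namespace Summit.QuantumFields.YangMills.Theorems.WeakCouplingMasslessPhase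

/-- **Assembly of route `WeakCouplingMasslessPhase`** (stmt-QuantumFields-19522): the route's deciding theorem, by name. -/
theorem assembly_proof : Summit.QuantumFields.YangMills.Theses.WeakCouplingMasslessPhase.Assembly :=
  fun h₁ h₂ => Summit.QuantumFields.YangMills.Theses.WeakCouplingMasslessPhase.closes h₁ h₂

end Summit.QuantumFields.YangMills.Theorems.WeakCouplingMasslessPhase
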